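import Summits.HodgeConjecture.HodgeCM.PerL34.ShimuraSetDecomposition_1

/-! PORT of `HodgeCM/PerL34/ShimuraSetDecomposition.lean` (HodgeCMPerL run 82) — part 2: continuation of `Summits.HodgeConjecture.HodgeCM.PerL34.ShimuraSetDecomposition_1` (split at a top-level declaration boundary by port_pkg.py; scope re-opened below; declarations unchanged). -/

-- port_pkg: scope re-opened for this part (file-level context, then the namespace/section stack open at the cut)
set_option autoImplicit false
noncomputable section
open scoped Pointwise
open Literature.AlgebraicGeometry.ShimuraVarieties
open HodgeCM.Adelic HodgeCM.PerL34.AdelicUnitaryFactorisation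
namespace HodgeCM.PerL34.Godement
section HermSpace3

variable (L : CMField) {ι₁ : L →+* ℂ} (V : HermSpace3 L ι₁)

/-- **PerL v5 §1.2 l. 70 (KERNEL): `S(K_f)` is a FINITE disjoint union of arithmetic quotients `Γ_i\G_U(ℝ)/C` by
DISCRETE COCOMPACT subgroups `Γ_i ≤ G_U(ℝ)`** — for every hermitian 3-space `V` over a CM field `L` with
`[L:ℚ] ≠ 2`, every compact open `K_f ≤ G_U(𝔸_{L₀,f})` and every subgroup `C ≤ G_U(ℝ)` (e.g. `K_∞`). -/
theorem _root_.HodgeCM.HermSpace3.shimuraSet_decomposition (hL : Module.finrank ℚ L ≠ 2)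
    (Kf : Subgroup (Ufin L V.Hm)) (hKo : IsOpen (Kf : Set (Ufin L V.Hm))) (hKc : IsCompact (Kf : Set (Ufin L V.Hm)))
    (C : Subgroup (Uinf L V.Hm)) :
    ∃ (ι : Type) (_ : Finite ι) (Γ : ι → Subgroup (Uinf L V.Hm)),
      (∀ i, DiscreteTopology (Γ i)) ∧ (∀ i, CompactSpace (Uinf L V.Hm ⧸ Γ i)) ∧
        Nonempty (ShimuraSet L V.Hm C Kf ≃
          Σ i : ι, DoubleCoset.Quotient (Γ i : Set (Uinf L V.Hm)) (C : Set (Uinf L V.Hm))) := by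
  refine ⟨DoubleCoset.Quotient (ratFin L V.Hm : Set (Ufin L V.Hm)) (Kf : Set (Ufin L V.Hm)),
    HodgeCM.HermSpace3.finite_doubleCoset_ratFin L V hL Kf hKo,
    fun j => congruenceLattice L V.Hm (MulAut.conj j.out • Kf), fun j => ?_, fun j => ?_,
    ⟨shimuraSetEquivOut L V.Hm C Kf⟩⟩
  · exact HodgeCM.HermSpace3.discreteTopology_congruenceLattice L V _ (isCompact_conj_smul Kf hKc _)
  · exact HodgeCM.HermSpace3.compactSpace_quotient_congruenceLattice L V hL _ (isOpen_conj_smul Kf hKo _)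

end HermSpace3

/-! Axiom audit of the headline results (expected: `propext`, `Classical.choice`, `Quot.sound` only). -/

end HodgeCM.PerL34.Godement

end
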